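import Summits.ResolutionOfSingularities.ResolutionOfSingularities.Theorems.WeightedInvariantHypersurfaceLocalGameEFT4SDimLEDoor
import Mathlib.RingTheory.GradedAlgebra.Homogeneous.Ideal
import Mathlib.RingTheory.Smooth.Basic
import Mathlib.RingTheory.RingHom.Smooth
import Mathlib.AlgebraicGeometry.Morphisms.Smooth
import HarnessLib

/-!
# THE GRADED DOOR-SETTING CLAUSE (c8-gr)≤d,p AND THE GRADED RUNG `PRungGrLE d p ι J` / `KeyRungGrLE d p`
# (door `HypersurfaceCentreConstruction`, stmt-ResolutionOfSingularities-19897, line `local-engine`; registrar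
# res-L1-w43-plan-1 ADDENDUM 2 to ORDER (o47) 2026-08-27T13:26:12Z and ORDER (o48) 13:42:46Z, SPEC rev 3
# `L/res-L1-w43-plan-1/DoorGraded_sketch.lean` sha16 857cd4ef45f4d598; typer res-type-098)

The e = 2 consumer of the P3 rung (`KeyRungLE 3 p`, `…EFT4SDimLEDoor`, res-type-098 p532502) reads the invariant `ι₃ᵗ`
only at ORBIT-GENERIC points of the graded unit charts of the cobordant tower — homogeneous primes `P` of a smooth affine
`k₀`-algebra `A` graded by `ℤʲ`, whose local rings `A_P` have Krull dimension `≤ 3` although `A` itself has dimension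
`3 + j` (registrar's FINDINGS 1–3 of the addendum) — and needs upper semicontinuity of `P ↦ ι (A_P) f` ON THE ORBIT SPACE
(the homogeneous spectrum with the subspace topology of `PrimeSpectrum A`), a shape the rung of record does not supply.
This module types that clause and the graded rung, ADDING it to `PRungLE` rather than replacing (c8)≤d,p (res-type-098's
amendment, VIEW 13:38:52Z, adopted in ORDER (o48)), so that every `PRungLE` seam transfers through `.1`:

* `IotaUpperSemicontinuousGradedLE d p ι` — (c8-gr)≤d,p: `A` smooth over a perfect field `k₀` of characteristic `p`, graded
  by `AddSubgroup`s indexed by `Fin j → ℤ` with the constants in degree `0` (the convention of the tree's `GradedAtlas`),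
  all HOMOGENEOUS primes with local rings of dimension `≤ d`, `f` homogeneous: every super-level set of `P ↦ ι (A_P) (f/1)`
  is closed in the subtype of homogeneous primes (Mathlib `Ideal.IsHomogeneous`, `SetLike.IsHomogeneousElem`,
  `GradedRing`; no ℕ-grading, no irrelevant ideal);
* `PRungGrLE d p ι J := PRungLE d p ι J ∧ IotaUpperSemicontinuousGradedLE d p ι`, `KeyRungGrLE d p := ∃ ι J, PRungGrLE d p ι J`;
* seams (sorry-free): `pRungGrLE_of_pRungLE`, `PRungGrLE.pRungLE`, `keyRungLE_of_keyRungGrLE`,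
  `iotaUpperSemicontinuousGradedLE_mono`, **`iotaUpperSemicontinuousGradedLE_of`** — the UNRESTRICTED (c6) + (c8) imply
  the graded clause at every `(d, p)` (u.s.c. on `Spec A` restricts to the homogeneous subspace; the stalks of `Spec A`
  are the localisations `A_P`: Mathlib `Spec.stalkIso`, `Spec.algebraMap_stalkIso_inv`; `Smooth (Spec A → Spec k₀)` from
  `Algebra.Smooth` by `HasRingHomProperty.Spec_iff`), `pRungGrLE_of_pRung`, `pRungGrLE_mono`, `keyRungGrLE_of_dimLE`,
  `keyRungGrLE_of_eft4S` (the KEY still implies the graded rung), `keyRungGrLE_mono`, `keyRungGrLE_two` (the P2 witness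
  `(iotaOrd, jContact)` satisfies the unrestricted clauses), `keyRungGrLE_three_of_pair` (concluder seam of a v3.9 stub
  `stub_keyRungGrLE_three : ∀ p, p.Prime → KeyRungGrLE 3 p`).

Definitions and plumbing only; NO mathematics beyond transport of structure.  The registrar's sketch rev 3 is filed
near-verbatim (binders and proofs unchanged).  [OURS · candidates · conjecture-grade design objects; nothing here asserts
anything about Hironaka's problem; NOT a statement of the manuscript under review (Hironaka 2017,
[claim: Hironaka2017, status: under-review]); AI planning/typing, weaker than expert review.]

## References

* res-L1-w43-plan-1, ADDENDUM 2 to ORDER (o47) (HOME/STATUS 2026-08-27T13:26:12Z), ORDER (o48) (13:42:46Z), SPEC rev 3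
  `L/res-L1-w43-plan-1/DoorGraded_sketch.lean`; IOTA3-DESIGN v1.3.3 §9.10 (OURS, AI planning).
* A. Grothendieck, ÉGA I (1960), §1.3 (stalks of `Spec A` are the localisations `A_𝔭`). [folklore]
-/

set_option linter.dupNamespace false -- mandated namespace of this single-conjunct summit

namespace Summit.ResolutionOfSingularities.ResolutionOfSingularities.Cruxes.HypersurfaceCentreConstruction.LocalEngine

/-- (c8-gr)≤d,p — upper semicontinuity of `ι` on the HOMOGENEOUS spectrum of a smooth `ℤʲ`-graded affine `k₀`-algebra whose
homogeneous primes have local rings of dimension `≤ d`, for homogeneous `f`. [OURS · candidate clause of the rung `PRungGrLE d p` · registrar res-L1-w43-plan-1, ADDENDUM 2 to (o47) / ORDER (o48)] -/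
def IotaUpperSemicontinuousGradedLE (d p : ℕ) (ι : (R : Type) → [CommRing R] → R → Ordinal.{0}) : Prop :=
  ∀ (k₀ : Type) [Field k₀] [CharP k₀ p] [PerfectField k₀]
    (A : Type) [CommRing A] [Algebra k₀ A] [Algebra.Smooth k₀ A]
    (j : ℕ) (𝒜 : (Fin j → ℤ) → AddSubgroup A) [GradedRing 𝒜],
    (∀ c : k₀, algebraMap k₀ A c ∈ 𝒜 0) →
    (∀ P : PrimeSpectrum A, P.asIdeal.IsHomogeneous 𝒜 →
      ringKrullDim (Localization.AtPrime P.asIdeal) ≤ d) →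
    ∀ (f : A), SetLike.IsHomogeneousElem 𝒜 f → ∀ (α : Ordinal.{0}),
      IsClosed {P : {P : PrimeSpectrum A // P.asIdeal.IsHomogeneous 𝒜} |
        α ≤ ι (Localization.AtPrime P.1.asIdeal) (algebraMap A (Localization.AtPrime P.1.asIdeal) f)}

/-- The graded rung: `PRungLE d p` AND (c8-gr)≤d,p (ADD, not replace — res-type-098's amendment 13:38:52Z: every `PRungLE` seam
transfers through `.1`). [OURS · candidate · registrar res-L1-w43-plan-1, ORDER (o48)] -/
def PRungGrLE (d p : ℕ) (ι : (R : Type) → [CommRing R] → R → Ordinal.{0})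
    (J : (R : Type) → [CommRing R] → R → ℕ → Ideal R) : Prop :=
  PRungLE d p ι J ∧ IotaUpperSemicontinuousGradedLE d p ι

/-- ∃-closure of the graded rung. [OURS · candidate · registrar res-L1-w43-plan-1, ORDER (o48)] -/
def KeyRungGrLE (d p : ℕ) : Prop :=
  ∃ (ι : (R : Type) → [CommRing R] → R → Ordinal.{0}) (J : (R : Type) → [CommRing R] → R → ℕ → Ideal R),
    PRungGrLE d p ι J

/-- Seam: a pair satisfying `PRungLE` and the graded clause satisfies `PRungGrLE`. [OURS · seam · ORDER (o48)] -/
theorem pRungGrLE_of_pRungLE {d p : ℕ} {ι : (R : Type) → [CommRing R] → R → Ordinal.{0}}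
    {J : (R : Type) → [CommRing R] → R → ℕ → Ideal R}
    (h : PRungLE d p ι J) (h8 : IotaUpperSemicontinuousGradedLE d p ι) : PRungGrLE d p ι J :=
  ⟨h, h8⟩

/-- Seam: the graded rung projects to the rung of record. [OURS · seam · ORDER (o48)] -/
theorem PRungGrLE.pRungLE {d p : ℕ} {ι : (R : Type) → [CommRing R] → R → Ordinal.{0}}
    {J : (R : Type) → [CommRing R] → R → ℕ → Ideal R} (h : PRungGrLE d p ι J) : PRungLE d p ι J := h.1

/-- Seam: `KeyRungGrLE d p → KeyRungLE d p`. [OURS · seam · ORDER (o48)] -/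
theorem keyRungLE_of_keyRungGrLE {d p : ℕ} (h : KeyRungGrLE d p) : KeyRungLE d p := by
  obtain ⟨ι, J, hιJ⟩ := h
  exact ⟨ι, J, hιJ.1⟩

/-- Seam: antitone in `d`. [OURS · seam · ORDER (o48)] -/
theorem iotaUpperSemicontinuousGradedLE_mono {d d' : ℕ} (hdd' : d ≤ d') (p : ℕ)
    {ι : (R : Type) → [CommRing R] → R → Ordinal.{0}} (h : IotaUpperSemicontinuousGradedLE d' p ι) :
    IotaUpperSemicontinuousGradedLE d p ι := by
  intro k₀ _ _ _ A _ _ _ j 𝒜 _ h0 hdim f hf α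
  exact h k₀ A j 𝒜 h0 (fun P hP => (hdim P hP).trans (by exact_mod_cast hdd')) f hf α

open AlgebraicGeometry in
/-- KEY SEAM: the UNRESTRICTED clauses (c6) + (c8) imply the graded clause (every `d`, `p`): u.s.c. on `Spec A` restricts to the
subspace of homogeneous primes, the stalks of `Spec A` being the localisations `A_P`. Hence `KeyRung_eft4S`-level witnesses and the
P2 witness `iotaOrd` satisfy (c8-gr). [OURS · seam · ORDER (o48)] -/
theorem iotaUpperSemicontinuousGradedLE_of (d p : ℕ) {ι : (R : Type) → [CommRing R] → R → Ordinal.{0}}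
    (h6 : IotaIsoInvariant ι) (h8 : IotaUpperSemicontinuous ι) : IotaUpperSemicontinuousGradedLE d p ι := by
  intro k₀ _ _ _ A _ _ _ j 𝒜 _ h0 hdim f hf α
  let R : CommRingCat.{0} := CommRingCat.of A
  let hY : Spec R ⟶ Spec (CommRingCat.of k₀) := Spec.map (CommRingCat.ofHom (algebraMap k₀ A))
  haveI : Smooth hY := by
    rw [HasRingHomProperty.Spec_iff (P := @Smooth)]
    show RingHom.Smooth (algebraMap k₀ A)
    exact RingHom.smooth_algebraMap.mpr inferInstance
  haveI : QuasiCompact hY := HasAffineProperty.iff_of_isAffine.mpr (inferInstance : CompactSpace _)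
  let f' : Γ(Spec R, ⊤) := (Scheme.ΓSpecIso R).inv f
  have hc := h8 k₀ (Spec R) hY f' α
  have hset : {y : ↥(Spec R) | α ≤ ι ((Spec R).presheaf.stalk y) ((Spec R).presheaf.germ ⊤ y trivial f')} =
      {P : PrimeSpectrum A | α ≤ ι (Localization.AtPrime P.asIdeal)
        (algebraMap A (Localization.AtPrime P.asIdeal) f)} := by
    ext y
    have hg : (Spec R).presheaf.germ ⊤ y trivial f' =
        (Spec.stalkIso R y).inv (algebraMap A (Localization.AtPrime y.asIdeal) f) := by
      have h := CategoryTheory.ConcreteCategory.congr_hom (Spec.algebraMap_stalkIso_inv (R := R) y) f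
      simp only [CategoryTheory.ConcreteCategory.comp_apply] at h
      exact h.symm
    have hι : ι ((Spec R).presheaf.stalk y) ((Spec.stalkIso R y).inv (algebraMap A (Localization.AtPrime y.asIdeal) f)) =
        ι (Localization.AtPrime y.asIdeal) (algebraMap A (Localization.AtPrime y.asIdeal) f) :=
      h6 _ _ (Spec.stalkIso R y).symm.commRingCatIsoToRingEquiv (algebraMap A _ f)
    show α ≤ _ ↔ α ≤ _
    rw [hg, hι]
  rw [hset] at hc
  exact hc.preimage continuous_subtype_val

/-- Seam: an UNRESTRICTED rung pair is a graded door-setting pair (via `iotaUpperSemicontinuousGradedLE_of`). [OURS · seam · ORDER (o48)] -/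
theorem pRungGrLE_of_pRung (d p : ℕ) (ι : (R : Type) → [CommRing R] → R → Ordinal.{0})
    (J : (R : Type) → [CommRing R] → R → ℕ → Ideal R) (h : PRung d p ι J) : PRungGrLE d p ι J :=
  ⟨pRungLE_of_pRung ι J d p h, iotaUpperSemicontinuousGradedLE_of d p h.1 h.2.2.1⟩

/-- Seam: antitone in `d`. [OURS · seam · ORDER (o48)] -/
theorem pRungGrLE_mono {d d' : ℕ} (hdd' : d ≤ d') (p : ℕ) {ι : (R : Type) → [CommRing R] → R → Ordinal.{0}}
    {J : (R : Type) → [CommRing R] → R → ℕ → Ideal R} (h : PRungGrLE d' p ι J) : PRungGrLE d p ι J :=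
  ⟨pRungLE_mono ι J hdd' p h.1, iotaUpperSemicontinuousGradedLE_mono hdd' p h.2⟩

/-- Seam: the unrestricted ∃-closed rung gives the graded door-setting one. [OURS · seam · ORDER (o48)] -/
theorem keyRungGrLE_of_dimLE (d p : ℕ) (h : LocalWeightedDropEFT4SDimLE d p) : KeyRungGrLE d p := by
  obtain ⟨ι, J, hr⟩ := h
  exact ⟨ι, J, pRungGrLE_of_pRung d p ι J hr⟩

/-- **The KEY implies the graded door-setting rung at every dimension bound.** [OURS · seam · ORDER (o48)] -/
theorem keyRungGrLE_of_eft4S (d p : ℕ) (h : LocalWeightedDropEFT4S p) : KeyRungGrLE d p :=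
  keyRungGrLE_of_dimLE d p (localWeightedDropEFT4SDimLE_of_eft4S d p h)

/-- Seam: antitone in `d`. [OURS · seam · ORDER (o48)] -/
theorem keyRungGrLE_mono {d d' : ℕ} (hdd' : d ≤ d') (p : ℕ) (h : KeyRungGrLE d' p) : KeyRungGrLE d p := by
  obtain ⟨ι, J, hr⟩ := h
  exact ⟨ι, J, pRungGrLE_mono hdd' p hr⟩

/-- **`KeyRungGrLE 2 p` for every prime `p`** (the P2 rung stays closed under the graded re-typing): the P2 witness
`(iotaOrd, jContact)` satisfies the UNRESTRICTED clauses. [OURS · seam · ORDER (o48)] -/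
theorem keyRungGrLE_two : ∀ p : ℕ, p.Prime → KeyRungGrLE 2 p := fun p hp =>
  ⟨iotaOrd, jContact, pRungGrLE_of_pRung 2 p iotaOrd jContact ((pRung_two_iff p iotaOrd jContact).mpr
    (stub_keyRung_dimLETwo p hp))⟩

/-- Concluder seam for a v3.9 stub `stub_keyRungGrLE_three : ∀ p, p.Prime → KeyRungGrLE 3 p`: a NAMED pair closes it.
[OURS · seam · ORDER (o48)] -/
theorem keyRungGrLE_three_of_pair (ι : (R : Type) → [CommRing R] → R → Ordinal.{0})
    (J : (R : Type) → [CommRing R] → R → ℕ → Ideal R) (h : ∀ p : ℕ, p.Prime → PRungGrLE 3 p ι J) :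
    ∀ p : ℕ, p.Prime → KeyRungGrLE 3 p := fun p hp =>
  ⟨ι, J, h p hp⟩

end Summit.ResolutionOfSingularities.ResolutionOfSingularities.Cruxes.HypersurfaceCentreConstruction.LocalEngine
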